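import Summits.AtomisticToContinuum.HydrodynamicLimit.Theorems.RelayRaceLocalityNearConstantShortTimeHLTiltL2Qlip
import Summits.AtomisticToContinuum.HydrodynamicLimit.Theorems.RelayRaceLocalityNearConstantShortTimeHLTiltL2Shift
import Summits.AtomisticToContinuum.HydrodynamicLimit.Theorems.RelayRaceLocalityNearConstantShortTimeHLTiltL2SameBlock
import Summits.AtomisticToContinuum.HydrodynamicLimit.Theorems.RelayRaceLocalityNearConstantShortTimeHLTiltL2Variance
import Summits.AtomisticToContinuum.HydrodynamicLimit.Theorems.RelayRaceLocalityNearConstantShortTimeHLTiltL2CoefRate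
import Summits.AtomisticToContinuum.HydrodynamicLimit.Theorems.RelayRaceLocalityNearConstantShortTimeHLTiltL2RatioRate
import Summits.AtomisticToContinuum.HydrodynamicLimit.Theorems.RelayRaceLocalityNearConstantShortTimeHLTiltL2OnePoint
import Summits.AtomisticToContinuum.HydrodynamicLimit.Theorems.RelayRaceLocalityNearConstantShortTimeHLTiltL2ContTilt
import Summits.AtomisticToContinuum.HydrodynamicLimit.Theorems.RelayRaceLocalityNearConstantShortTimeHLTiltL2Smoothing
import Summits.AtomisticToContinuum.HydrodynamicLimit.Theorems.RelayRaceLocalityNearConstantShortTimeHLEndgame4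
import HarnessLib

/-!
# Crux `NearConstantShortTimeHL` (stmt-AtomisticToContinuum-12502), line `small-tilt-domination`, skeleton v16 — THE STATICS SIDE CLOSES:
# `BallTiltLogLaplace`, `MesoscaleDensityLD`, and the crux from the four dynamical conjectures alone

Support file (`--supports stmt-AtomisticToContinuum-12502`). Composition of the nine landed helpers of the L² route (`…TiltL2Defs`):
* `stub_varianceL2 : VarianceL2` (registered skeleton stub) `:= tl_varianceL2_of (tl_onePointShift tl_insertionRatioLipschitz) tl_sameBlockL2`
  — the L² variance bound `Var(Σ g(xᵢ)) ≤ K n ∫ g² dμ` of the canonical dilute hard-sphere gas;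
* `stub_onePointUniform : OnePointUniform` (registered skeleton stub) `:= tl_onePointUniform_of2 tl_coefRateNonneg tl_ratioRate` — the uniform
  one-point limit (local density approximation with a rate);
* `stub_ballTilt_of : VarianceL2 → OnePointUniform → BallTiltLogLaplace` (registered skeleton stub) — tilting (`tl_contTilt_of`) and smoothing
  (`tl_ballTilt_of_contTilt`);
hence `ballTiltLogLaplace_holds : BallTiltLogLaplace` (the analytic core D2 of the line, formerly conjecture-grade), `mesoscaleDensityLD_holds :
MesoscaleDensityLD` (the whole statics residue St2′-D, via the landed net reduction `stub_densityLD_of_ballTilt`), and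
`nearConstantShortTimeHL_of_dynamics4` — THE CRUX from the four DYNAMICAL conjectures alone (`MomentumClosureTightness4`,
`EnergyClosureTightness4`, `TrueLawCapsG`, `FourthMomentCapPreShock`; `nearConstantShortTimeHL_of_ballTilt4`).
References: E. Pulvirenti – D. Tsagkarogiannis, Comm. Math. Phys. 316 (2012) Thm 2.1; H.-T. Yau, Lett. Math. Phys. 22 (1991) §2.
-/

noncomputable section

namespace Summit.AtomisticToContinuum.HydrodynamicLimit.Theorems.NearConstantShortTimeHL

open Summit.AtomisticToContinuum.HydrodynamicLimit.Theses.RelayRaceLocality (NearConstantShortTimeHL)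

/-- **D2a — THE L² VARIANCE BOUND** (registered skeleton stub `stub_varianceL2` of v16): insertion ratios Lipschitz in the particle number
(`tl_insertionRatioLipschitz`) ⇒ one-point shift bound (`tl_onePointShift`); with the same-block remainder in L² form (`tl_sameBlockL2`) the
variance assembly `tl_varianceL2_of` concludes. [cite: PulvirentiTsagkarogiannis2012, Thm 2.1] -/
theorem stub_varianceL2 : VarianceL2 :=
  tl_varianceL2_of (tl_onePointShift tl_insertionRatioLipschitz) tl_sameBlockL2

/-- **D2b — THE UNIFORM ONE-POINT LIMIT** (registered skeleton stub `stub_onePointUniform` of v16): the cluster limit with a rate for `σ ≥ 0`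
(`tl_coefRateNonneg`) and the insertion ratios with a rate (`tl_ratioRate`) feed the centring assembly `tl_onePointUniform_of2`.
[cite: PulvirentiTsagkarogiannis2012, Thm 2.1] -/
theorem stub_onePointUniform : OnePointUniform :=
  tl_onePointUniform_of2 tl_coefRateNonneg tl_ratioRate

/-- **D2c — THE TRANSFER** (registered skeleton stub `stub_ballTilt_of` of v16): tilting (`tl_contTilt_of`) and smoothing of the ball-average
tilts (`tl_ballTilt_of_contTilt`). [cite: Yau1991, §2] -/
theorem stub_ballTilt_of : VarianceL2 → OnePointUniform → BallTiltLogLaplace :=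
  fun hV hU => tl_ballTilt_of_contTilt (tl_contTilt_of hV hU)

/-- **`ContTiltLogLaplace` HOLDS**: the uniform quadratic log-Laplace bound for ALL continuous tilts `|G| ≤ 1` of the matched canonical dilute
hard-sphere gas (a by-product of the route, of independent interest: Gaussian concentration of linear statistics with the L² variance proxy).
[cite: PulvirentiTsagkarogiannis2012, Thm 2.1] [cite: Yau1991, §2] -/
theorem contTiltLogLaplace_holds : ContTiltLogLaplace :=
  tl_contTilt_of stub_varianceL2 stub_onePointUniform

/-- **`BallTiltLogLaplace` HOLDS**: the uniform quadratic log-Laplace bound for ball-average linear statistics of the matched canonical dilute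
hard-sphere gas (the analytic core D2 of the line `small-tilt-domination`). [cite: PulvirentiTsagkarogiannis2012, Thm 2.1] [cite: Yau1991, §2] -/
theorem ballTiltLogLaplace_holds : BallTiltLogLaplace :=
  stub_ballTilt_of stub_varianceL2 stub_onePointUniform

/-- **`MesoscaleDensityLD` HOLDS**: the mesoscale density large deviation of the canonical hard-sphere gas (the statics residue St2′-D of the line),
by the landed net reduction `stub_densityLD_of_ballTilt`. [cite: Yau1991, §2] -/
theorem mesoscaleDensityLD_holds : MesoscaleDensityLD :=
  stub_densityLD_of_ballTilt ballTiltLogLaplace_holds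

/-- **THE CRUX FROM THE FOUR DYNAMICAL CONJECTURES ALONE.** With the statics side of the line `small-tilt-domination` closed, the hydrodynamic-limit
crux `NearConstantShortTimeHL` follows from the equilibrium momentum / energy closure tightness under the fourth-moment cap (S2″, S3″), the a-priori
caps with Gaussian velocity tails along the true law (S4′) and the fourth-moment cap along the true law (S4d). [cite: Yau1991, §2] -/
theorem nearConstantShortTimeHL_of_dynamics4 :
    MomentumClosureTightness4 → EnergyClosureTightness4 → TrueLawCapsG → FourthMomentCapPreShock → NearConstantShortTimeHL :=
  nearConstantShortTimeHL_of_ballTilt4 ballTiltLogLaplace_holds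

end Summit.AtomisticToContinuum.HydrodynamicLimit.Theorems.NearConstantShortTimeHL

end
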